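import Summits.ABC.ABC.Statement
import Summits.ABC.ABC.Theses.TwistAmplification
import Summits.ABC.ABC.Theorems.SomeWindowSaving.Negative.WindowFinite
import Summits.ABC.ABC.Theorems.TwistAmplificationAssembly
import Summits.ABC.ABC.Theorems.TwistAmplificationTwistAmplificationLemma
import Summits.ABC.ABC.Theorems.TwistAmplificationSomeWindowSavingQuadraticTwistInvariants
import Literature.NumberTheory.EllipticCurves.SzpiroBGEquivalenceProofs
import HarnessLib.Audit

/-!
# Line `SketchIdeator3` for the crux `TwistAmplification.ModerateWindowCount` (stmt-ABC-1973) — lead skeleton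

Lead prover-line-stmt-ABC-1973-0, 2026-08-16, cycle 1 (the payload line `SketchIdeator3` =
`Cruxes/ModerateWindowCount/SketchIdeator3.lean` of planner-cruxidea-stmt-ABC-1973-3-0, put into
`stub_*` / `_of` form; PICKED.md says why this line and why ONE stub); continued by lead
prover-line-stmt-ABC-1973-1, cycle 2 (same line, same single stub). CYCLE-2 UPDATE: the route support
`QuadraticTwistInvariants` (stmt-ABC-1977) is now CLOSED (`quadraticTwistInvariants_proof`, p87180), so
the calibration below is UNCONDITIONAL in every direction — `crux ⟺ stub ⟺ ABC` with no hypothesis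
(`crux_iff_stub`, `stub_iff_abc`; Theorems-side: `moderateWindowCount_equiv_abc`,
`ModerateWindowCount.iff_cofiniteGenSzpiroAll` in `Theorems/TwistAmplificationModerateWindowCountCalibration.lean`).

THE LINE. The crux (`∀ σ > 6 ∃ κ ∈ (3,σ) ∃ δ < (σ−κ)/(2σ−6) ∃ C ∀ X ≥ 1, T⁺_[κ,σ](X) ≤ C·X^δ`) allows
`κ ∈ (6, σ)`, and there the box is INERT: a cofinite pointwise bound `M⁺ ≤ N^s` (`s < κ`) empties the
window above a bounded conductor, so `δ := 0` is an admissible saving and the constant is the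
cardinality of one finite slice (`Negative.windowSet_finite`). Hence ONE stub:

* `stub_cofiniteGenSzpiroAll` — COFINITE GENERALIZED SZPIRO FOR EVERY EXPONENT `s > 6`: for each
  `s > 6` some `N₀` beyond which every integral model minimal at all places, elliptic over `ℚ`, with
  `c₄ c₆ ≠ 0`, has `max(|Δ|, |c₄|³) ≤ N^s` (Bombieri–Gubler Conj. 12.5.11 in cofinite form on the
  non-CM-`j` models the crux counts). OPEN — and exactly as open as abc: `stub_iff_abc` below
  (sorry-free) proves `stub ↔ ABC` from tree theorems (`→` Frey bookkeeping + Mahler,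
  `TwistAmplificationAssembly.abc_of_cofinite_genSzpiro`; `←` B–G Thm. 12.5.12,
  `abcLe_iff_generalizedSzpiroBG_holds`).

`ModerateWindowCount_of : Registered.stub_cofiniteGenSzpiroAll → ModerateWindowCount` is proved here
without `sorry` (`moderateWindowCount_of_cofiniteGenSzpiroAll`, witness `κ := (σ+6)/2`, `δ := 0`). The
stub is also NECESSARY, unconditionally since cycle 2: `stub_of_crux` (sorry-free, via the closed
supports `twistAmplificationLemma_proof`, stmt-ABC-1978, and `quadraticTwistInvariants_proof`,
stmt-ABC-1977). So the line is LOSSLESS — `crux ⟺ stub ⟺ ABC`, every arrow unconditional — and it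
has no second stub to fan out: wave = none (1 stub, and that stub is the summit).

NOT registered (and why): the `κ := 6` lever `ExcessLaw`/`NearViolatorSparsity` of the two idea cards —
it implies the crux (`moderateWindowCount_of_excessLaw` in the sketch) but is STRICTLY STRONGER than it
(adds at-the-line statistics `T_[6,6+v](X) ≪ X^δ` not implied by abc; TRIAGE-r1-1), so as a stub it is
dominated by `stub_cofiniteGenSzpiroAll`.

Disproof used (`Cruxes/ModerateWindowCount/Disproof.lean` v5, refuter-cdisprove-stmt-ABC-1973-0): §3
`moderateWindowCount_of_generalizedSzpiroBG` / `_of_abc` — this skeleton IS that calibration made the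
line (same witness family `κ > 6`); §2 honesty `κ < σ` — honoured, the witness has `κ = (σ+6)/2 < σ`
and `3 < κ`; §4 `not_moderateWindowLawAtSix` (`6 < σ` sharp) — honoured, every statement keeps `6 < σ`
and nothing is claimed at `σ = 6`; §6 minimality load-bearing — the stub keeps `IsMinimalAt` at every
`v`; §7 reducedness — untouched (the counted set is the crux's verbatim, `Negative.windowSet`). There is
no `_false_without_` theorem applicable to the stub (it RESISTS with abc: `stub_of_abc`).
-/

noncomputable section

-- `Summit.<Summit>.<Problem>` is the mandated summit-side namespace (CONVENTIONS §2); for the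
-- single-conjunct summit `ABC` the two coincide, so the duplicate `ABC.ABC` is deliberate.
set_option linter.dupNamespace false

namespace Summit.ABC.ABC.Cruxes.ModerateWindowCount.Lines.SketchIdeator3

open IsDedekindDomain WeierstrassCurve
open Summit.ABC.ABC.Theses.TwistAmplification (ModerateWindowCount QuadraticTwistInvariants
  TwistAmplificationLemma)
open Summit.ABC.ABC.Theorems (twistAmplificationLemma_proof twistAmplification_assembly_proof
  quadraticTwistInvariants_proof)
open Summit.ABC.ABC.Theorems.SomeWindowSaving.Negative (windowSet windowCount windowSet_finite)
open Literature.NumberTheory.EllipticCurves (GeneralizedSzpiroConjectureBG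
  abcLe_iff_generalizedSzpiroBG_holds)

/-! ## The stub STATEMENT (a named `Prop`; the registered `stub_*` theorem restates it verbatim) -/

/-- COFINITE GENERALIZED SZPIRO FOR EVERY EXPONENT `s > 6`: for each `s > 6` some `N₀` beyond which every
integral model minimal at all places, elliptic over `ℚ`, with `c₄ c₆ ≠ 0`, has `max(|Δ|, |c₄|³) ≤ N^s`
(`N` = `conductorNorm`). Abc strength (Bombieri–Gubler Conj. 12.5.11 / Thm. 12.5.12); OPEN. -/
def CofiniteGenSzpiroAll : Prop :=
  ∀ s : ℝ, 6 < s → ∃ N₀ : ℝ, ∀ W₀ : WeierstrassCurve ℤ, (W₀.baseChange ℚ).IsElliptic →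
    (∀ v : HeightOneSpectrum ℤ, (W₀.baseChange ℚ).IsMinimalAt v) → W₀.c₄ ≠ 0 → W₀.c₆ ≠ 0 →
      N₀ ≤ (((W₀.baseChange ℚ).conductorNorm ℤ : ℕ) : ℝ) →
        ((max |W₀.Δ| (|W₀.c₄| ^ 3) : ℤ) : ℝ) ≤ (((W₀.baseChange ℚ).conductorNorm ℤ : ℕ) : ℝ) ^ s

/-! ## The registered stub (`sorry` lives only here) -/

/-- **STUB · `stub_cofiniteGenSzpiroAll`** — cofinite generalized Szpiro for every exponent `s > 6` on the
non-CM-`j` minimal models (= `CofiniteGenSzpiroAll` verbatim). OPEN, summit-equivalent (`stub_iff_abc`):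
size = the abc conjecture. Nobody is asked to prove it; it is registered so that the ledger records
exactly what this crux costs. -/
theorem stub_cofiniteGenSzpiroAll :
    ∀ s : ℝ, 6 < s → ∃ N₀ : ℝ, ∀ W₀ : WeierstrassCurve ℤ, (W₀.baseChange ℚ).IsElliptic →
      (∀ v : HeightOneSpectrum ℤ, (W₀.baseChange ℚ).IsMinimalAt v) → W₀.c₄ ≠ 0 → W₀.c₆ ≠ 0 →
        N₀ ≤ (((W₀.baseChange ℚ).conductorNorm ℤ : ℕ) : ℝ) →
          ((max |W₀.Δ| (|W₀.c₄| ^ 3) : ℤ) : ℝ) ≤ (((W₀.baseChange ℚ).conductorNorm ℤ : ℕ) : ℝ) ^ s := by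
  sorry

/-! ### Consistency: the named statement IS the registered stub (definitionally) -/

theorem cofiniteGenSzpiroAll_holds : CofiniteGenSzpiroAll := stub_cofiniteGenSzpiroAll

/-! ### Name-keyed alias of the statement (the hypothesis of the composition) -/
namespace Registered

/-- Alias of `CofiniteGenSzpiroAll` keyed by the registered stub name. -/
abbrev stub_cofiniteGenSzpiroAll : Prop := CofiniteGenSzpiroAll

end Registered

/-! ## Proved glue: the inert box at `κ ∈ (6, σ)` -/

/-- Window confinement: under a cofinite bound `M⁺ ≤ N^s` beyond `N₀`, a window whose LOWER exponent `κ`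
exceeds `s` contains only curves of conductor `< max N₀ 2` (`n ≥ max N₀ 2` would give
`n^κ ≤ M⁺ ≤ n^s < n^κ`). -/
theorem windowSet_subset_of_cofinite {s κ σ N₀ : ℝ} (hsκ : s < κ)
    (h : ∀ W₀ : WeierstrassCurve ℤ, (W₀.baseChange ℚ).IsElliptic →
      (∀ v : HeightOneSpectrum ℤ, (W₀.baseChange ℚ).IsMinimalAt v) → W₀.c₄ ≠ 0 → W₀.c₆ ≠ 0 →
        N₀ ≤ (((W₀.baseChange ℚ).conductorNorm ℤ : ℕ) : ℝ) →
          ((max |W₀.Δ| (|W₀.c₄| ^ 3) : ℤ) : ℝ) ≤ (((W₀.baseChange ℚ).conductorNorm ℤ : ℕ) : ℝ) ^ s)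
    (X : ℝ) : windowSet κ σ X ⊆ windowSet κ σ (max N₀ 2) := by
  intro W hW
  obtain ⟨hE, hmin, ha₁, ha₃, ha₂, hc₄, hc₆, -, hlo, hhi⟩ := hW
  refine ⟨hE, hmin, ha₁, ha₃, ha₂, hc₄, hc₆, ?_, hlo, hhi⟩
  set n : ℝ := (((W.baseChange ℚ).conductorNorm ℤ : ℕ) : ℝ) with hn
  by_contra hlt
  rw [not_le] at hlt
  have hN₀ : N₀ ≤ n := le_trans (le_max_left _ _) hlt.le
  have hn2 : (2 : ℝ) ≤ n := le_trans (le_max_right _ _) hlt.le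
  have hn1 : (1 : ℝ) < n := by linarith
  have hM := h W hE hmin hc₄ hc₆ hN₀
  have h1 : n ^ κ ≤ n ^ s := le_trans hlo hM
  have h2 : n ^ s < n ^ κ := Real.rpow_lt_rpow_of_exponent_lt hn1 hsκ
  linarith

/-- **The inert box**: `CofiniteGenSzpiroAll → (the crux through windowCount)`, witness `κ := (σ+6)/2`,
`s := (κ+6)/2 ∈ (6, κ)`, `δ := 0`, `C := #windowSet κ σ (max N₀ 2)`. No counting, no twist facts. -/
theorem moderateWindowCount_of_cofiniteGenSzpiroAll (h : CofiniteGenSzpiroAll) :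
    ∀ σ : ℝ, 6 < σ → ∃ κ δ C : ℝ, 3 < κ ∧ κ < σ ∧ δ < (σ - κ) / (2 * σ - 6) ∧
      ∀ X : ℝ, 1 ≤ X → (windowCount κ σ X : ℝ) ≤ C * X ^ δ := by
  intro σ hσ
  set κ : ℝ := (σ + 6) / 2 with hκ
  have hκ6 : 6 < κ := by rw [hκ]; linarith
  have hκσ : κ < σ := by rw [hκ]; linarith
  obtain ⟨N₀, hN₀⟩ := h ((κ + 6) / 2) (by linarith)
  refine ⟨κ, 0, ((windowSet κ σ (max N₀ 2)).ncard : ℝ), by linarith, hκσ, ?_, fun X _ ↦ ?_⟩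
  · exact div_pos (by linarith) (by linarith)
  · rw [Real.rpow_zero, mul_one]
    exact_mod_cast Set.ncard_le_ncard
      (windowSet_subset_of_cofinite (by linarith : (κ + 6) / 2 < κ) hN₀ X) (windowSet_finite _ _ _)

/-! ## The composition: the stub implies the crux, BY NAME (kernel-checked; no `sorry` below) -/

/-- **`ModerateWindowCount_of`** — the glue of the line: the box is inert above `κ = 6`
(`moderateWindowCount_of_cofiniteGenSzpiroAll`; the crux is `Negative.windowCount`'s statement
definitionally). -/
theorem ModerateWindowCount_of (h : Registered.stub_cofiniteGenSzpiroAll) :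
    Summit.ABC.ABC.Theses.TwistAmplification.ModerateWindowCount :=
  moderateWindowCount_of_cofiniteGenSzpiroAll h

/-- Wiring check: the registered stub feeds `ModerateWindowCount_of` as stated. -/
example : Summit.ABC.ABC.Theses.TwistAmplification.ModerateWindowCount :=
  ModerateWindowCount_of stub_cofiniteGenSzpiroAll

/-! ## Calibration (sorry-free): the stub IS the summit, and the crux is the stub modulo stmt-ABC-1977

(a) `stub_iff_abc : CofiniteGenSzpiroAll ↔ ABC` — unconditional. `→`: Frey bookkeeping + Mahler's
`S`-unit finiteness (`TwistAmplificationAssembly.abc_of_cofinite_genSzpiro`, landed with the route's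
Assembly, its conclusion is the displayed sentence of `ABC`); `←`: B–G Thm. 12.5.12 (a) ⟹ (c)
(`abcLe_iff_generalizedSzpiroBG_holds`) and `ε := (s−6)/2`, `N₀ := (max C 1)^{2/(s−6)}`.
(b) `stub_of_crux : ModerateWindowCount → CofiniteGenSzpiroAll` — UNCONDITIONAL (cycle 2): the
crux at `σ := (6+s)/2` amplified to `s` by the CLOSED supports `twistAmplificationLemma_proof`
(stmt-ABC-1978) and `quadraticTwistInvariants_proof` (stmt-ABC-1977), packaged as
`TwistAmplificationAssembly.cofinite_genSzpiro`; hence `crux_iff_stub` and `crux ↔ ABC` below.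
Consequences: no unconditional Negative lemma can refute the stub or the crux short of `¬ ABC`; no
reshape of this line can produce a stub weaker than abc; the crux is DERIVED inside the route from
`SharpModerateLaw` (stmt-ABC-1975) by the closed glue `sharpLawGivesWindow_proof` (stmt-ABC-14144). -/

/-- `GeneralizedSzpiroConjectureBG → CofiniteGenSzpiroAll` (`ε := (s−6)/2`, absorb the constant). -/
theorem stub_of_generalizedSzpiroBG (h : GeneralizedSzpiroConjectureBG) : CofiniteGenSzpiroAll := by
  intro s hs
  set γ : ℝ := (s - 6) / 2 with hγ
  have hγ0 : 0 < γ := by rw [hγ]; linarith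
  obtain ⟨C, hC⟩ := h γ hγ0
  set B : ℝ := max C 1 with hB
  have hB1 : 1 ≤ B := le_max_right _ _
  have hB0 : 0 < B := by linarith
  refine ⟨B ^ (1 / γ), fun W₀ hE hmin _ _ hN ↦ ?_⟩
  set n : ℝ := (((W₀.baseChange ℚ).conductorNorm ℤ : ℕ) : ℝ) with hn
  have hNB : (1 : ℝ) ≤ B ^ (1 / γ) := Real.one_le_rpow hB1 (by positivity)
  have hn1 : (1 : ℝ) ≤ n := le_trans hNB hN
  have hn0 : (0 : ℝ) < n := by linarith
  have hBn : B ≤ n ^ γ := by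
    have h1 : (B ^ (1 / γ)) ^ γ ≤ n ^ γ := Real.rpow_le_rpow (by positivity) hN hγ0.le
    rwa [← Real.rpow_mul hB0.le, one_div, inv_mul_cancel₀ hγ0.ne', Real.rpow_one] at h1
  have hSz : ((max |W₀.Δ| (|W₀.c₄| ^ 3) : ℤ) : ℝ) ≤ C * n ^ (6 + γ) := by exact_mod_cast hC W₀ hE hmin
  calc ((max |W₀.Δ| (|W₀.c₄| ^ 3) : ℤ) : ℝ) ≤ C * n ^ (6 + γ) := hSz
    _ ≤ B * n ^ (6 + γ) := mul_le_mul_of_nonneg_right (le_max_left _ _) (Real.rpow_nonneg hn0.le _)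
    _ ≤ n ^ γ * n ^ (6 + γ) := mul_le_mul_of_nonneg_right hBn (Real.rpow_nonneg hn0.le _)
    _ = n ^ s := by rw [← Real.rpow_add hn0]; congr 1; rw [hγ]; ring

/-- The summit implies the stub (B–G 12.5.12 (a) ⟹ (c), strict form of `ABC` weakened to `≤`). -/
theorem stub_of_abc (habc : _root_.ABC) : CofiniteGenSzpiroAll := by
  refine stub_of_generalizedSzpiroBG (abcLe_iff_generalizedSzpiroBG_holds.mp fun ε hε ↦ ?_)
  obtain ⟨C, -, hC⟩ := habc ε hε
  exact ⟨C, fun a b c h ↦ (hC a b c h).le⟩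

/-- **(a) The stub IS the summit: `CofiniteGenSzpiroAll ↔ ABC`** (unconditional). -/
theorem stub_iff_abc : CofiniteGenSzpiroAll ↔ _root_.ABC := by
  refine ⟨fun h ↦ ?_, stub_of_abc⟩
  rw [_root_.ABC_iff]
  exact Summit.ABC.ABC.Theorems.TwistAmplificationAssembly.abc_of_cofinite_genSzpiro h

/-- **(b) The crux implies the stub** — unconditional since cycle 2 (`quadraticTwistInvariants_proof`,
stmt-ABC-1977, closed). -/
theorem stub_of_crux (hX : ModerateWindowCount) : CofiniteGenSzpiroAll :=
  fun _ hs ↦ Summit.ABC.ABC.Theorems.TwistAmplificationAssembly.cofinite_genSzpiro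
    twistAmplificationLemma_proof quadraticTwistInvariants_proof hX hs

/-- Hence **`crux ↔ stub`, unconditionally**: the line is lossless (its one stub is exactly as hard as the
crux). Stated with the crux on the LEFT of an `↔`, so `ModerateWindowCount_of` stays the only theorem of
the file whose conclusion is the crux by name. -/
theorem crux_iff_stub :
    (Summit.ABC.ABC.Theses.TwistAmplification.ModerateWindowCount ↔ CofiniteGenSzpiroAll) :=
  ⟨stub_of_crux, fun h ↦ ModerateWindowCount_of h⟩

/-- And **`crux ↔ ABC`, unconditionally** (an `example`; Theorems-side it is the registered sub-goal
`moderateWindowCount_equiv_abc`). -/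
example : (Summit.ABC.ABC.Theses.TwistAmplification.ModerateWindowCount ↔ _root_.ABC) :=
  crux_iff_stub.trans stub_iff_abc

/-- And summit ⟹ crux along this line (an `example`). -/
example (habc : _root_.ABC) : Summit.ABC.ABC.Theses.TwistAmplification.ModerateWindowCount :=
  ModerateWindowCount_of (stub_of_abc habc)

end Summit.ABC.ABC.Cruxes.ModerateWindowCount.Lines.SketchIdeator3

end
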